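import Summits.AtomisticToContinuum.Crystallization.Theorems.PhononSlackCertificatesPeriodicGivenLayeredLayerCake3

/-!
# `PeriodicGivenLayered` (stmt-AtomisticToContinuum-11779), line `Sketch`, helper for stub `stub_layerCake`:
# the prisms `W(m₁, n, K)` of a layered set

Support file for the crux `PhononSlackCertificates.PeriodicGivenLayered` (= `HullMinimality.PeriodicGivenLayered`).
Deliverable (e) of the stub (`cake_prisms`): for `S = S(A, s, z)` and the prism `W = W(m₁, n, K)` (layers
`m₁ ≤ m < m₁ + n`, a `K × K` rhombus of sites per layer, laterally re-centred by `⌊L m / 3⌋ (u + v)`):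
`W ⊆ S`, `#W = n K²`, `∑_{p ∈ W} e_p(S) = K² ∑_m ε_m` (site-energy identity of part 3), and
`∑_{p ∈ W} (1 + dist(p, S ∖ W))⁻³ ≤ 192 (n K + K²)`: a point of `S ∖ W` has re-centred indices (`cake_recentre'`)
outside the index box, hence is `≥ (d - 1)/4` away from a prism point of index depth `d` (`cake_dist_recentred_ge`,
coordinate-wise triangle inequalities, `|Δr| ≤ 2`, `√3 ≥ 17/10`); the weight `64/(d+3)³` is dominated by the six
one-directional weights, each family summing to `≤ 32` per line (`cake_sum_weight_le`, `cake_sum_box_*`).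
-/

namespace Summit.AtomisticToContinuum.Crystallization.Theorems.LayeredHull

open Literature.MathematicalPhysics.StatisticalMechanics

/-- Every layered point in re-centred coordinates:
`layerVec a h L 1 i j = layerVec a h (L % 3) 1 (i + L/3) (j + L/3)`. [folklore] -/
theorem cake_recentre' (a h : ℝ) (L i j : ℤ) :
    layerVec a h L 1 i j = layerVec a h (L % 3) 1 (i + L / 3) (j + L / 3) := by
  have := cake_recentre a h L (i + L / 3) (j + L / 3)
  simp only [add_sub_cancel_right] at this
  rw [← this, cake_pt_eq_layerVec]

/-- **Far indices are far points.** For `a ∈ [47/50, 1]`, heights with increments `≥ 39a/50`, letters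
`r, r' ∈ {0, 1, 2}` and integer in-plane coordinates: if the layer indices differ by `≥ d + 1`, or one of the two
in-plane index differences is `≥ d + 1` in absolute value, then the two re-centred points are `≥ (d - 1)/4` apart.
[folklore] -/
theorem cake_dist_recentred_ge (a : ℝ) (ha : 47 / 50 ≤ a) (z : ℤ → ℝ)
    (hz : ∀ m : ℤ, 39 / 50 * a ≤ z (m + 1) - z m) {r r' : ℤ} (hr : 0 ≤ r) (hr3 : r < 3)
    (hr' : 0 ≤ r') (hr'3 : r' < 3) (m m' x y x' y' : ℤ) (d : ℕ)
    (hcase : (d : ℤ) + 1 ≤ |m' - m| ∨ (d : ℤ) + 1 ≤ |x' - x| ∨ (d : ℤ) + 1 ≤ |y' - y|) :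
    ((d : ℝ) - 1) / 4 ≤ ‖layerVec a (z m' - z m) (r' - r) 1 (x' - x) (y' - y)‖ := by
  set N := ‖layerVec a (z m' - z m) (r' - r) 1 (x' - x) (y' - y)‖ with hN
  have ha0 : 0 ≤ a := by linarith
  obtain ⟨Δx, hΔx⟩ : ∃ Δx : ℝ, Δx = ((x' - x : ℤ) : ℝ) := ⟨_, rfl⟩
  obtain ⟨Δy, hΔy⟩ : ∃ Δy : ℝ, Δy = ((y' - y : ℤ) : ℝ) := ⟨_, rfl⟩
  obtain ⟨Δr, hΔr⟩ : ∃ Δr : ℝ, Δr = ((r' - r : ℤ) : ℝ) := ⟨_, rfl⟩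
  have hΔr2 : |Δr| ≤ 2 := by
    have h1 : (r' - r : ℤ) ≤ 2 := by omega
    have h2 : (-2 : ℤ) ≤ r' - r := by omega
    rw [hΔr, abs_le]
    exact ⟨by exact_mod_cast h2, by exact_mod_cast h1⟩
  -- coordinate lower bounds
  have hT : a / 2 * |2 * Δx + Δy + Δr| ≤ N := by
    have h := cake_abs_fst_le_norm a (z m' - z m) (r' - r) (x' - x) (y' - y)
    have e : a * (((x' - x : ℤ) : ℝ) + ((y' - y : ℤ) : ℝ) / 2 + ((r' - r : ℤ) : ℝ) / 2) =
        a / 2 * (2 * Δx + Δy + Δr) := by rw [hΔx, hΔy, hΔr]; ring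
    rwa [e, abs_mul, abs_of_nonneg (by positivity : (0 : ℝ) ≤ a / 2)] at h
  have hU : a * √3 / 6 * |3 * Δy + Δr| ≤ N := by
    have h := cake_abs_snd_le_norm a (z m' - z m) (r' - r) (x' - x) (y' - y)
    have e : a * √3 / 2 * (((y' - y : ℤ) : ℝ) + ((r' - r : ℤ) : ℝ) / 3) =
        a * √3 / 6 * (3 * Δy + Δr) := by rw [hΔy, hΔr]; ring
    rwa [e, abs_mul, abs_of_nonneg (by positivity : (0 : ℝ) ≤ a * √3 / 6)] at h
  have hZ : |z m' - z m| ≤ N := cake_abs_height_le_norm a (z m' - z m) (r' - r) (x' - x) (y' - y)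
  -- numerical constants
  have h3 : (17 / 10 : ℝ) ≤ √3 := Real.le_sqrt_of_sq_le (by norm_num)
  have hκ1 : (47 / 100 : ℝ) ≤ a / 2 := by linarith
  have hκ2 : (1598 / 6000 : ℝ) ≤ a * √3 / 6 := by nlinarith
  have hκ3 : (7332 / 10000 : ℝ) ≤ 39 / 50 * a := by linarith
  -- triangle inequalities
  have hTx : 2 * |Δx| ≤ |2 * Δx + Δy + Δr| + |Δy| + |Δr| := by
    have e : 2 * Δx = (2 * Δx + Δy + Δr) + (-Δy) + (-Δr) := by ring
    calc 2 * |Δx| = |2 * Δx| := by rw [abs_mul, abs_two]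
      _ = |(2 * Δx + Δy + Δr) + (-Δy) + (-Δr)| := by rw [← e]
      _ ≤ |2 * Δx + Δy + Δr| + |-Δy| + |-Δr| := abs_add_three _ _ _
      _ = _ := by rw [abs_neg, abs_neg]
  have hUy : 3 * |Δy| ≤ |3 * Δy + Δr| + |Δr| := by
    have e : 3 * Δy = (3 * Δy + Δr) + (-Δr) := by ring
    calc 3 * |Δy| = |3 * Δy| := by rw [abs_mul]; norm_num
      _ = |(3 * Δy + Δr) + (-Δr)| := by rw [← e]
      _ ≤ |3 * Δy + Δr| + |-Δr| := abs_add_le _ _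
      _ = _ := by rw [abs_neg]
  rcases hcase with h | h | h
  · -- far layers: vertical distance
    have h' : (d : ℝ) + 1 ≤ |((m' : ℝ) - m)| := by exact_mod_cast h
    have h1 := cake_abs_height_diff_ge a ha0 z hz m m'
    have h2 : 7332 / 10000 * |((m' : ℝ) - m)| ≤ 39 / 50 * a * |((m' : ℝ) - m)| :=
      mul_le_mul_of_nonneg_right hκ3 (abs_nonneg _)
    linarith
  · -- far first index
    have h' : (d : ℝ) + 1 ≤ |Δx| := by rw [hΔx]; exact_mod_cast h
    by_cases hxy : |Δx| ≤ 2 * |Δy|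
    · have h2 : 1598 / 6000 * |3 * Δy + Δr| ≤ a * √3 / 6 * |3 * Δy + Δr| :=
        mul_le_mul_of_nonneg_right hκ2 (abs_nonneg _)
      linarith
    · push Not at hxy
      have h2 : 47 / 100 * |2 * Δx + Δy + Δr| ≤ a / 2 * |2 * Δx + Δy + Δr| :=
        mul_le_mul_of_nonneg_right hκ1 (abs_nonneg _)
      linarith
  · -- far second index
    have h' : (d : ℝ) + 1 ≤ |Δy| := by rw [hΔy]; exact_mod_cast h
    have h2 : 1598 / 6000 * |3 * Δy + Δr| ≤ a * √3 / 6 * |3 * Δy + Δr| :=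
      mul_le_mul_of_nonneg_right hκ2 (abs_nonneg _)
    linarith

/-- From a lower bound `(d - 1)/4` on a distance `D ≥ 0`... precisely on any real `D` with `(d-1)/4 ≤ D`:
`(1 + D)⁻¹ ³ ≤ 64 / (d + 3)³`. [folklore] -/
theorem cake_inv_cube_le_weight {D : ℝ} {d : ℕ} (hD : ((d : ℝ) - 1) / 4 ≤ D) :
    (1 + D)⁻¹ ^ 3 ≤ 64 / ((d : ℝ) + 3) ^ 3 := by
  have hpos : (0 : ℝ) < ((d : ℝ) + 3) / 4 := by positivity
  have h1 : ((d : ℝ) + 3) / 4 ≤ 1 + D := by linarith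
  have h2 : (1 + D)⁻¹ ≤ (((d : ℝ) + 3) / 4)⁻¹ := inv_anti₀ hpos h1
  have h3 : (0 : ℝ) ≤ (1 + D)⁻¹ := inv_nonneg.2 (by linarith)
  calc (1 + D)⁻¹ ^ 3 ≤ ((((d : ℝ) + 3) / 4)⁻¹) ^ 3 := pow_le_pow_left₀ h3 h2 3
    _ = 64 / ((d : ℝ) + 3) ^ 3 := by rw [inv_div, div_pow]; norm_num

/-- The weight of the least of six depths is at most the sum of the six weights (weights `≥ 0`). [folklore] -/
theorem cake_weight_min_le (B : ℕ → ℝ) (hB : ∀ k, 0 ≤ B k) (d₁ d₂ d₃ d₄ d₅ d₆ : ℕ) :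
    B (min (min d₁ d₂) (min (min d₃ d₄) (min d₅ d₆))) ≤ B d₁ + B d₂ + B d₃ + B d₄ + B d₅ + B d₆ := by
  have h₁ := hB d₁; have h₂ := hB d₂; have h₃ := hB d₃; have h₄ := hB d₄; have h₅ := hB d₅; have h₆ := hB d₆
  rcases min_choice (min d₁ d₂) (min (min d₃ d₄) (min d₅ d₆)) with h | h <;> rw [h]
  · rcases min_choice d₁ d₂ with h' | h' <;> rw [h'] <;> linarith
  · rcases min_choice (min d₃ d₄) (min d₅ d₆) with h' | h' <;> rw [h']
    · rcases min_choice d₃ d₄ with h'' | h'' <;> rw [h''] <;> linarith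
    · rcases min_choice d₅ d₆ with h'' | h'' <;> rw [h''] <;> linarith

/-- The boundary weights are summable with partial sums `≤ 32`: `64/(k+3)³ ≤ 64 (1/(k+2) - 1/(k+3))`. [folklore] -/
theorem cake_sum_weight_le (N : ℕ) : ∑ k ∈ Finset.range N, (64 : ℝ) / ((k : ℝ) + 3) ^ 3 ≤ 32 := by
  have hle : ∀ k : ℕ, (64 : ℝ) / ((k : ℝ) + 3) ^ 3 ≤ 64 * (1 / ((k : ℝ) + 2) - 1 / ((k : ℝ) + 3)) := by
    intro k
    have hk : (0 : ℝ) ≤ k := Nat.cast_nonneg k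
    have e : (1 : ℝ) / ((k : ℝ) + 2) - 1 / ((k : ℝ) + 3) = 1 / (((k : ℝ) + 2) * ((k : ℝ) + 3)) := by
      field_simp; ring
    rw [e, mul_one_div]
    have hmono : ((k : ℝ) + 2) * ((k : ℝ) + 3) ≤ ((k : ℝ) + 3) ^ 3 := by
      have h1 : (k : ℝ) + 2 ≤ ((k : ℝ) + 3) ^ 2 := by nlinarith
      calc ((k : ℝ) + 2) * ((k : ℝ) + 3) ≤ ((k : ℝ) + 3) ^ 2 * ((k : ℝ) + 3) :=
            mul_le_mul_of_nonneg_right h1 (by positivity)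
        _ = ((k : ℝ) + 3) ^ 3 := by ring
    exact div_le_div_of_nonneg_left (by norm_num) (by positivity) hmono
  have htel : ∀ N : ℕ, ∑ k ∈ Finset.range N, ((1 : ℝ) / ((k : ℝ) + 2) - 1 / ((k : ℝ) + 3)) =
      1 / 2 - 1 / ((N : ℝ) + 2) := by
    intro N
    induction N with
    | zero => norm_num
    | succ N ih =>
      rw [Finset.sum_range_succ, ih]
      push_cast
      ring
  calc ∑ k ∈ Finset.range N, (64 : ℝ) / ((k : ℝ) + 3) ^ 3
      ≤ ∑ k ∈ Finset.range N, 64 * (1 / ((k : ℝ) + 2) - 1 / ((k : ℝ) + 3)) := Finset.sum_le_sum fun k _ => hle k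
    _ = 64 * (1 / 2 - 1 / ((N : ℝ) + 2)) := by rw [← Finset.mul_sum, htel]
    _ ≤ 32 := by
        have : (0 : ℝ) ≤ 1 / ((N : ℝ) + 2) := by positivity
        linarith

/-- Reindexing an integer interval of length `n` by `Finset.range n`. [folklore] -/
theorem cake_sum_Ico_eq_sum_range (f : ℤ → ℝ) (m₁ : ℤ) (n : ℕ) :
    ∑ m ∈ Finset.Ico m₁ (m₁ + n), f m = ∑ k ∈ Finset.range n, f (m₁ + k) := by
  have himage : (Finset.range n).image (fun k : ℕ => m₁ + k) = Finset.Ico m₁ (m₁ + n) := by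
    ext m
    simp only [Finset.mem_image, Finset.mem_range, Finset.mem_Ico]
    constructor
    · rintro ⟨k, hk, rfl⟩; omega
    · intro h; exact ⟨(m - m₁).toNat, by omega, by omega⟩
  rw [← himage, Finset.sum_image]
  intro k _ k' _ h
  have : (k : ℤ) = k' := by linarith
  exact_mod_cast this

/-- Sums over the index box of a prism of a function of the first in-plane index. [folklore] -/
theorem cake_sum_box_fst (g : ℕ → ℝ) (m₁ : ℤ) (n K : ℕ) :
    ∑ t ∈ Finset.Ico m₁ (m₁ + n) ×ˢ (Finset.range K ×ˢ Finset.range K), g t.2.1 =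
      n * (K * ∑ x ∈ Finset.range K, g x) := by
  have h1 : (((m₁ + n - m₁).toNat : ℕ) : ℝ) = n := by simp
  rw [Finset.sum_product]
  dsimp only
  rw [Finset.sum_const, Int.card_Ico, nsmul_eq_mul, Finset.sum_product, h1]
  dsimp only
  congr 1
  rw [Finset.mul_sum]
  exact Finset.sum_congr rfl fun x _ => by rw [Finset.sum_const, Finset.card_range, nsmul_eq_mul]

/-- Sums over the index box of a prism of a function of the second in-plane index. [folklore] -/
theorem cake_sum_box_snd (g : ℕ → ℝ) (m₁ : ℤ) (n K : ℕ) :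
    ∑ t ∈ Finset.Ico m₁ (m₁ + n) ×ˢ (Finset.range K ×ˢ Finset.range K), g t.2.2 =
      n * (K * ∑ y ∈ Finset.range K, g y) := by
  have h1 : (((m₁ + n - m₁).toNat : ℕ) : ℝ) = n := by simp
  rw [Finset.sum_product]
  dsimp only
  rw [Finset.sum_const, Int.card_Ico, nsmul_eq_mul, Finset.sum_product, h1]
  dsimp only
  rw [Finset.sum_const, Finset.card_range, nsmul_eq_mul]

/-- Sums over the index box of a prism of a function of the layer index. [folklore] -/
theorem cake_sum_box_layer (g : ℤ → ℝ) (m₁ : ℤ) (n K : ℕ) :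
    ∑ t ∈ Finset.Ico m₁ (m₁ + n) ×ˢ (Finset.range K ×ˢ Finset.range K), g t.1 =
      (K : ℝ) ^ 2 * ∑ m ∈ Finset.Ico m₁ (m₁ + n), g m := by
  rw [Finset.sum_product, Finset.mul_sum]
  refine Finset.sum_congr rfl fun m _ => ?_
  dsimp only
  rw [Finset.sum_const, Finset.card_product, Finset.card_range, nsmul_eq_mul]
  push_cast
  ring

/-- **Deliverable (e): the prisms of a layered set.** See the module docstring. The set `S` and the prism `W`
are taken as named arguments with their defining equations (instantiate with `rfl`). [folklore] -/
theorem cake_prisms (a : ℝ) (ha : 47 / 50 ≤ a) (ha1 : a ≤ 1) (A : (EuclideanSpace ℝ (Fin 3)) →ₗᵢ[ℝ]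
    (EuclideanSpace ℝ (Fin 3))) (s : ℤ → ℤ)
    (z : ℤ → ℝ) (hz : ∀ m : ℤ, 39 / 50 * a ≤ z (m + 1) - z m) (m₁ : ℤ) (n K : ℕ)
    (S : Set (EuclideanSpace ℝ (Fin 3))) (hS : S = {p | ∃ m i j : ℤ, p = A (((i : ℝ) • triangularVec₁ a) +
      ((j : ℝ) • triangularVec₂ a) + ((haggLabel s m : ℝ) • barlowOffset a) + (z m • layerNormal 1))})
    (W : Finset (EuclideanSpace ℝ (Fin 3))) (hW : W = ((Finset.Ico m₁ (m₁ + n)) ×ˢ ((Finset.range K) ×ˢ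
        (Finset.range K))).image
      fun t : ℤ × (ℕ × ℕ) => A (((((t.2.1 : ℤ) - haggLabel s t.1 / 3 : ℤ) : ℝ) • triangularVec₁ a) +
        ((((t.2.2 : ℤ) - haggLabel s t.1 / 3 : ℤ) : ℝ) • triangularVec₂ a) +
        ((haggLabel s t.1 : ℝ) • barlowOffset a) + (z t.1 • layerNormal 1))) :
    (↑W : Set (EuclideanSpace ℝ (Fin 3))) ⊆ S ∧ W.card = n * K ^ 2 ∧
    (∑ p ∈ W, (∑' q : {q : (EuclideanSpace ℝ (Fin 3)) // q ∈ S ∧ q ≠ p}, lennardJones (dist p (q :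
        (EuclideanSpace ℝ (Fin 3)))))) =
      (K : ℝ) ^ 2 * ∑ m ∈ Finset.Ico m₁ (m₁ + n), (inLayerInteraction lennardJones a +
        ∑' m' : ℤ, if m' = m then (0 : ℝ) else
          layerInteraction lennardJones a (z m' - z m) (haggLabel s m' - haggLabel s m) 1) ∧
    (∑ p ∈ W, (1 + Metric.infDist p (S \ (↑W : Set (EuclideanSpace ℝ (Fin 3)))))⁻¹ ^ 3) ≤ 192 * (n * K + K ^ 2)
        := by
  have ha0 : 0 < a := by linarith
  have hzinj : Function.Injective z := cake_height_injective a ha0 z hz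
  -- the parametrisation of the prism
  set P : ℤ × (ℕ × ℕ) → (EuclideanSpace ℝ (Fin 3)) := fun t : ℤ × (ℕ × ℕ) =>
    A (((((t.2.1 : ℤ) - haggLabel s t.1 / 3 : ℤ) : ℝ) • triangularVec₁ a) +
      ((((t.2.2 : ℤ) - haggLabel s t.1 / 3 : ℤ) : ℝ) • triangularVec₂ a) +
      ((haggLabel s t.1 : ℝ) • barlowOffset a) + (z t.1 • layerNormal 1)) with hP
  subst hW
  have hPt : ∀ (m : ℤ) (x y : ℕ), P (m, (x, y)) = A (layerVec a (z m) (haggLabel s m % 3) 1 x y) := by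
    intro m x y
    simp only [hP, cake_recentre]
  have hinjP : Function.Injective P := by
    rintro ⟨m, x, y⟩ ⟨m', x', y'⟩ h
    rw [hPt, hPt] at h
    obtain ⟨h1, h2, h3⟩ :=
      cake_param_injective a ha0.ne' (fun m => haggLabel s m % 3) z hzinj (A.injective h)
    subst h1
    have h2' : x = x' := by exact_mod_cast h2
    have h3' : y = y' := by exact_mod_cast h3
    rw [h2', h3']
  have hPS : ∀ t, P t ∈ S := fun t => by
    rw [hS]
    exact ⟨t.1, (t.2.1 : ℤ) - haggLabel s t.1 / 3, (t.2.2 : ℤ) - haggLabel s t.1 / 3, rfl⟩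
  refine ⟨?_, ?_, ?_, ?_⟩
  · -- `W ⊆ S`
    intro p hp
    rw [Finset.mem_coe, Finset.mem_image] at hp
    obtain ⟨t, -, rfl⟩ := hp
    exact hPS t
  · -- `#W = n K²`
    rw [Finset.card_image_of_injective _ hinjP, Finset.card_product, Finset.card_product,
      Finset.card_range, Int.card_Ico]
    have hI : (m₁ + (n : ℤ) - m₁).toNat = n := by simp
    rw [hI]
    ring
  · -- the energy of the prism
    rw [Finset.sum_image fun t _ t' _ h => hinjP h]
    have hE : ∀ t ∈ Finset.Ico m₁ (m₁ + n) ×ˢ (Finset.range K ×ˢ Finset.range K),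
        (∑' q : {q : (EuclideanSpace ℝ (Fin 3)) // q ∈ S ∧ q ≠ P t}, lennardJones (dist (P t) (q :
            (EuclideanSpace ℝ (Fin 3))))) =
          inLayerInteraction lennardJones a + ∑' m' : ℤ, (if m' = t.1 then (0 : ℝ) else
            layerInteraction lennardJones a (z m' - z t.1) (haggLabel s m' - haggLabel s t.1) 1) := by
      intro t _
      subst hS
      exact cake_siteEnergy a ha ha1 A s z hz t.1 ((t.2.1 : ℤ) - haggLabel s t.1 / 3)
        ((t.2.2 : ℤ) - haggLabel s t.1 / 3)
    rw [Finset.sum_congr rfl hE]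
    exact cake_sum_box_layer (fun m => inLayerInteraction lennardJones a + ∑' m' : ℤ,
      (if m' = m then (0 : ℝ) else
        layerInteraction lennardJones a (z m' - z m) (haggLabel s m' - haggLabel s m) 1)) m₁ n K
  · -- the boundary sum
    rw [Finset.sum_image fun t _ t' _ h => hinjP h]
    set B : ℕ → ℝ := fun k => 64 / ((k : ℝ) + 3) ^ 3 with hB
    have hB0 : ∀ k, 0 ≤ B k := fun k => by positivity
    -- a point of `S` outside the prism
    have hne : (S \ ↑((Finset.Ico m₁ (m₁ + n) ×ˢ (Finset.range K ×ˢ Finset.range K)).image P)).Nonempty := by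
      refine ⟨A (layerVec a (z (m₁ - 1)) (haggLabel s (m₁ - 1)) 1 0 0), ?_, ?_⟩
      · rw [hS]
        exact ⟨m₁ - 1, 0, 0, by rw [cake_pt_eq_layerVec]⟩
      · intro hmem
        rw [Finset.mem_coe, Finset.mem_image] at hmem
        obtain ⟨⟨m', x', y'⟩, ht', heq⟩ := hmem
        rw [hPt] at heq
        have h2 := congrArg (fun v : (EuclideanSpace ℝ (Fin 3)) => v 2) (A.injective heq)
        simp only [cake_layerVec_apply_two] at h2
        have h3 := hzinj h2
        simp only [Finset.mem_product, Finset.mem_Ico] at ht'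
        omega
    -- the per-point bound
    have hpt : ∀ t ∈ Finset.Ico m₁ (m₁ + n) ×ˢ (Finset.range K ×ˢ Finset.range K),
        (1 + Metric.infDist (P t)
          (S \ ↑((Finset.Ico m₁ (m₁ + n) ×ˢ (Finset.range K ×ˢ Finset.range K)).image P)))⁻¹ ^ 3 ≤
        B t.2.1 + B (K - 1 - t.2.1) + B t.2.2 + B (K - 1 - t.2.2) + B (t.1 - m₁).toNat +
          B (m₁ + n - 1 - t.1).toNat := by
      rintro ⟨m, x, y⟩ ht
      simp only [Finset.mem_product, Finset.mem_Ico, Finset.mem_range] at ht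
      obtain ⟨⟨hm1, hm2⟩, hx, hy⟩ := ht
      dsimp only
      set dmin : ℕ := min (min x (K - 1 - x)) (min (min y (K - 1 - y))
        (min (m - m₁).toNat (m₁ + n - 1 - m).toNat)) with hdmin
      have hd1 : dmin ≤ x := (min_le_left _ _).trans (min_le_left _ _)
      have hd2 : dmin ≤ K - 1 - x := (min_le_left _ _).trans (min_le_right _ _)
      have hd3 : dmin ≤ y := (min_le_right _ _).trans ((min_le_left _ _).trans (min_le_left _ _))
      have hd4 : dmin ≤ K - 1 - y := (min_le_right _ _).trans ((min_le_left _ _).trans (min_le_right _ _))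
      have hd5 : dmin ≤ (m - m₁).toNat := (min_le_right _ _).trans ((min_le_right _ _).trans (min_le_left _ _))
      have hd6 : dmin ≤ (m₁ + n - 1 - m).toNat :=
        (min_le_right _ _).trans ((min_le_right _ _).trans (min_le_right _ _))
      have hinf : ((dmin : ℝ) - 1) / 4 ≤ Metric.infDist (P (m, (x, y)))
          (S \ ↑((Finset.Ico m₁ (m₁ + n) ×ˢ (Finset.range K ×ˢ Finset.range K)).image P)) := by
        refine (Metric.le_infDist hne).2 fun q hq => ?_
        obtain ⟨hqS, hqW⟩ := hq
        rw [hS] at hqS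
        obtain ⟨m', i', j', rfl⟩ := hqS
        set x' : ℤ := i' + haggLabel s m' / 3 with hx'
        set y' : ℤ := j' + haggLabel s m' / 3 with hy'
        have hq_eq : A (((i' : ℝ) • triangularVec₁ a) + ((j' : ℝ) • triangularVec₂ a) +
            ((haggLabel s m' : ℝ) • barlowOffset a) + (z m' • layerNormal 1)) =
            A (layerVec a (z m') (haggLabel s m' % 3) 1 x' y') := by
          rw [cake_pt_eq_layerVec, cake_recentre']
        have hbox : ¬ (m₁ ≤ m' ∧ m' < m₁ + n ∧ 0 ≤ x' ∧ x' < K ∧ 0 ≤ y' ∧ y' < K) := by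
          rintro ⟨h1, h2, h3, h4, h5, h6⟩
          apply hqW
          rw [Finset.mem_coe, Finset.mem_image]
          refine ⟨(m', (x'.toNat, y'.toNat)), ?_, ?_⟩
          · simp only [Finset.mem_product, Finset.mem_Ico, Finset.mem_range]
            omega
          · rw [hPt, hq_eq, Int.toNat_of_nonneg h3, Int.toNat_of_nonneg h5]
        have hcase : (dmin : ℤ) + 1 ≤ |m' - m| ∨ (dmin : ℤ) + 1 ≤ |x' - (x : ℤ)| ∨
            (dmin : ℤ) + 1 ≤ |y' - (y : ℤ)| := by
          by_cases c1 : m' < m₁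
          · exact Or.inl (le_abs.2 (Or.inr (by omega)))
          by_cases c2 : m₁ + n ≤ m'
          · exact Or.inl (le_abs.2 (Or.inl (by omega)))
          by_cases c3 : x' < 0
          · exact Or.inr (Or.inl (le_abs.2 (Or.inr (by omega))))
          by_cases c4 : (K : ℤ) ≤ x'
          · exact Or.inr (Or.inl (le_abs.2 (Or.inl (by omega))))
          by_cases c5 : y' < 0
          · exact Or.inr (Or.inr (le_abs.2 (Or.inr (by omega))))
          by_cases c6 : (K : ℤ) ≤ y'
          · exact Or.inr (Or.inr (le_abs.2 (Or.inl (by omega))))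
          exact absurd ⟨by omega, by omega, by omega, by omega, by omega, by omega⟩ hbox
        rw [hPt, hq_eq, LinearIsometry.dist_map, dist_comm, dist_eq_norm, cake_layerVec_sub]
        exact cake_dist_recentred_ge a ha z hz (Int.emod_nonneg _ (by norm_num))
          (Int.emod_lt_of_pos _ (by norm_num)) (Int.emod_nonneg _ (by norm_num))
          (Int.emod_lt_of_pos _ (by norm_num)) m m' x y x' y' dmin hcase
      exact (cake_inv_cube_le_weight hinf).trans (cake_weight_min_le B hB0 _ _ _ _ _ _)
    -- summing the per-point bounds
    have e1 : ∑ t ∈ Finset.Ico m₁ (m₁ + n) ×ˢ (Finset.range K ×ˢ Finset.range K), B t.2.1 =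
        n * (K * ∑ x ∈ Finset.range K, B x) := cake_sum_box_fst B m₁ n K
    have e2 : ∑ t ∈ Finset.Ico m₁ (m₁ + n) ×ˢ (Finset.range K ×ˢ Finset.range K), B (K - 1 - t.2.1) =
        n * (K * ∑ x ∈ Finset.range K, B (K - 1 - x)) := cake_sum_box_fst (fun x => B (K - 1 - x)) m₁ n K
    have e3 : ∑ t ∈ Finset.Ico m₁ (m₁ + n) ×ˢ (Finset.range K ×ˢ Finset.range K), B t.2.2 =
        n * (K * ∑ y ∈ Finset.range K, B y) := cake_sum_box_snd B m₁ n K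
    have e4 : ∑ t ∈ Finset.Ico m₁ (m₁ + n) ×ˢ (Finset.range K ×ˢ Finset.range K), B (K - 1 - t.2.2) =
        n * (K * ∑ y ∈ Finset.range K, B (K - 1 - y)) := cake_sum_box_snd (fun y => B (K - 1 - y)) m₁ n K
    have e5 : ∑ t ∈ Finset.Ico m₁ (m₁ + n) ×ˢ (Finset.range K ×ˢ Finset.range K), B (t.1 - m₁).toNat =
        (K : ℝ) ^ 2 * ∑ m ∈ Finset.Ico m₁ (m₁ + n), B (m - m₁).toNat :=
      cake_sum_box_layer (fun m => B (m - m₁).toNat) m₁ n K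
    have e6 : ∑ t ∈ Finset.Ico m₁ (m₁ + n) ×ˢ (Finset.range K ×ˢ Finset.range K),
        B (m₁ + n - 1 - t.1).toNat =
        (K : ℝ) ^ 2 * ∑ m ∈ Finset.Ico m₁ (m₁ + n), B (m₁ + n - 1 - m).toNat :=
      cake_sum_box_layer (fun m => B (m₁ + n - 1 - m).toNat) m₁ n K
    have s1 : ∑ x ∈ Finset.range K, B x ≤ 32 := cake_sum_weight_le K
    have s2 : ∑ x ∈ Finset.range K, B (K - 1 - x) ≤ 32 := by
      rw [Finset.sum_range_reflect B K]; exact cake_sum_weight_le K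
    have s5 : ∑ m ∈ Finset.Ico m₁ (m₁ + n), B (m - m₁).toNat ≤ 32 := by
      rw [cake_sum_Ico_eq_sum_range]
      have : ∀ k ∈ Finset.range n, B (m₁ + (k : ℤ) - m₁).toNat = B k := fun k _ => by
        congr 1; omega
      rw [Finset.sum_congr rfl this]; exact cake_sum_weight_le n
    have s6 : ∑ m ∈ Finset.Ico m₁ (m₁ + n), B (m₁ + n - 1 - m).toNat ≤ 32 := by
      rw [cake_sum_Ico_eq_sum_range]
      have : ∀ k ∈ Finset.range n, B (m₁ + n - 1 - (m₁ + (k : ℤ))).toNat = B (n - 1 - k) := fun k hk => by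
        congr 1
        have := Finset.mem_range.1 hk
        omega
      rw [Finset.sum_congr rfl this, Finset.sum_range_reflect B n]; exact cake_sum_weight_le n
    have hn : (0 : ℝ) ≤ n := Nat.cast_nonneg n
    have hK : (0 : ℝ) ≤ K := Nat.cast_nonneg K
    calc ∑ t ∈ Finset.Ico m₁ (m₁ + n) ×ˢ (Finset.range K ×ˢ Finset.range K), (1 + Metric.infDist (P t)
          (S \ ↑((Finset.Ico m₁ (m₁ + n) ×ˢ (Finset.range K ×ˢ Finset.range K)).image P)))⁻¹ ^ 3
        ≤ ∑ t ∈ Finset.Ico m₁ (m₁ + n) ×ˢ (Finset.range K ×ˢ Finset.range K),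
            (B t.2.1 + B (K - 1 - t.2.1) + B t.2.2 + B (K - 1 - t.2.2) + B (t.1 - m₁).toNat +
              B (m₁ + n - 1 - t.1).toNat) := Finset.sum_le_sum hpt
      _ = n * (K * ∑ x ∈ Finset.range K, B x) + n * (K * ∑ x ∈ Finset.range K, B (K - 1 - x)) +
            n * (K * ∑ y ∈ Finset.range K, B y) + n * (K * ∑ y ∈ Finset.range K, B (K - 1 - y)) +
            (K : ℝ) ^ 2 * ∑ m ∈ Finset.Ico m₁ (m₁ + n), B (m - m₁).toNat +
            (K : ℝ) ^ 2 * ∑ m ∈ Finset.Ico m₁ (m₁ + n), B (m₁ + n - 1 - m).toNat := by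
          simp only [Finset.sum_add_distrib]
          rw [e1, e2, e3, e4, e5, e6]
      _ ≤ n * (K * 32) + n * (K * 32) + n * (K * 32) + n * (K * 32) + (K : ℝ) ^ 2 * 32 +
            (K : ℝ) ^ 2 * 32 := by
          gcongr
      _ ≤ 192 * (n * K + K ^ 2) := by nlinarith [mul_nonneg hn hK, sq_nonneg (K : ℝ)]

end Summit.AtomisticToContinuum.Crystallization.Theorems.LayeredHull
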